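import Literature.Geometry.Riemannian.ExpMapLocalDiffeo
import Literature.Geometry.Riemannian.UniformlyNormalNeighbourhoods
import Literature.Geometry.Manifold.InverseFunctionTheorem
import HarnessLib

/-!
# Uniformly normal neighbourhoods of a connection: the two-point inverse of the exponential map

For a `C^∞` covariant derivative `cov` on the tangent bundle of a Hausdorff manifold `M` over a
boundaryless real model (finite-dimensional complete model space) — no completeness of `cov` is
assumed — we prove the connection-level form of "every point has a uniformly normal
neighbourhood" (Lee, *Introduction to Riemannian Manifolds* (2018), Prop. 5.19 (e) / Lemma 6.16;
O'Neill, *Semi-Riemannian geometry* (1983), Ch. 5, Lemma 5.5 ff., the map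
`E(v) = (π v, exp v)` is a local diffeomorphism at the zero section, whence for `q, z` near `p`
there is a unique small `v ∈ T_qM` with `exp_q v = z`, depending smoothly on `(q, z)`):

* `exists_twoPoint_expInverse` — for every `p` there are an open `W ∋ p` inside the chart domain
  of `p`, an open set `Src ⊆ M × E` of "small vectors read in the trivialisation `e₁` of `TM` at
  `p`" containing `W × {0}`, and a map `Ξ : M → M → E` such that
  (1) `(q, ξ) ↦ (q, exp_q (e₁⁻¹ ξ))` is injective on `Src` and `e₁⁻¹ ξ` lies in the domain `𝓔_q`
      of `exp_q` there;
  (2) for `q, z ∈ W`: `(q, Ξ q z) ∈ Src` and `exp_q (e₁⁻¹ (Ξ q z)) = z` — the two-point inverse;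
  (3) `(q, z) ↦ Ξ q z` is `C^∞` on `W × W`, and so is `(q, z) ↦ (q, e₁⁻¹(Ξ q z)) ∈ TM`.

Proof (Lee, proof of Prop. 5.19 (e)): read through the trivialisation `e₁` at `p`, the map
`F(q, ξ) = (q, exp_q(e₁⁻¹ ξ))` is a `C^∞` map between the product manifolds `M × E` and `M × M`
near `(p, 0)` (`exp` is `C^∞` on the open set `𝓔 ⊆ TM`, `contMDiffOn_expMap_totalSpace`; the
inverse trivialisation is `C^∞`, `Trivialization.contMDiffOn_symm`), with differential
`(a, b) ↦ (a, a + b)` at `(p, 0)` (`mfderiv_prod_eq_add_apply`; `d(exp_p)_0 = id`,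
`mfderiv_expMap_zero_apply`), an isomorphism; the inverse function theorem for manifolds
(`Literature.Geometry.Manifold.isLocalDiffeomorphAt_of_mfderiv`) gives a `PartialDiffeomorph`
agreeing with `F` near `(p, 0)`, whose inverse read on a product neighbourhood `W × W` of `(p, p)`
is the two-point inverse.

Everything is proved; no definitions and no named facts are introduced. Written for the local
causality theory of Lorentzian manifolds (O'Neill 1983, Ch. 5, Lemma 5.33, Prop. 5.34; Ch. 14,
Lemma 14.2), where the base point of the exponential chart has to move.

## References

* J. M. Lee, *Introduction to Riemannian Manifolds*, 2nd ed., GTM 176 (2018), Prop. 5.19 (e),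
  Lemma 6.16. [LeeRiemannianManifolds2018]
* B. O'Neill, *Semi-Riemannian geometry with applications to relativity*, Academic Press 1983,
  Ch. 5, Lemma 5 ff. and Prop. 7 (normal and convex neighbourhoods). [ONeillSemiRiemannian1983]
-/

noncomputable section

open Bundle Set Filter Function
open scoped Manifold ContDiff Topology

namespace Literature.Geometry.Riemannian

open Literature.Geometry.Lorentzian Literature.Geometry.Manifold

variable {E : Type*} [NormedAddCommGroup E] [NormedSpace ℝ E] {H : Type*} [TopologicalSpace H]
  {I : ModelWithCorners ℝ E H} {M : Type*} [TopologicalSpace M] [ChartedSpace H M]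
  [IsManifold I ∞ M] [FiniteDimensional ℝ E] [CompleteSpace E] [T2Space M] [I.Boundaryless]
  {cov : CovariantDerivative I E (TangentSpace I : M → Type _)}
  [CovariantDerivative.ContMDiffCovariantDerivative cov 1]
  [CovariantDerivative.ContMDiffCovariantDerivative cov (⊤ : ℕ∞)]

omit [FiniteDimensional ℝ E] [CompleteSpace E] in
/-- The linear equivalence `(a, b) ↦ (a, a + b)` of `E × E` (the differential of
`(q, ξ) ↦ (q, exp_q ξ)` at a point of the zero section). [folklore] -/
theorem exists_shearEquiv :
    ∃ L : (E × E) ≃L[ℝ] (E × E), ∀ a b : E, L (a, b) = (a, a + b) := by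
  refine ⟨ContinuousLinearEquiv.equivOfInverse
    ((ContinuousLinearMap.fst ℝ E E).prod (ContinuousLinearMap.fst ℝ E E + ContinuousLinearMap.snd ℝ E E))
    ((ContinuousLinearMap.fst ℝ E E).prod (ContinuousLinearMap.snd ℝ E E - ContinuousLinearMap.fst ℝ E E))
    (fun z ↦ ?_) (fun z ↦ ?_), fun a b ↦ rfl⟩
  · obtain ⟨a, b⟩ := z
    simp
  · obtain ⟨a, c⟩ := z
    simp

/-- **Uniformly normal neighbourhoods of a `C^∞` connection: the two-point inverse of `exp`**
(Lee 2018, Prop. 5.19 (e); O'Neill 1983, Ch. 5, Lemma 5 ff.). See the module docstring for the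
statement and the proof. The vectors are read in the trivialisation
`e₁ = trivializationAt E (TangentSpace I) p` of `TM` at `p` (over its base set, the chart domain of
`p`), through the everywhere-defined linear inverse `e₁.symmL ℝ q : E →L[ℝ] T_qM`.
[cite: LeeRiemannianManifolds2018, Prop. 5.19 (e)] -/
theorem exists_twoPoint_expInverse (p : M) :
    ∃ (W : Set M) (Src : Set (M × E)) (Ξ : M → M → E),
      IsOpen W ∧ p ∈ W ∧ W ⊆ (chartAt H p).source ∧ IsOpen Src ∧ (∀ q ∈ W, (q, (0 : E)) ∈ Src) ∧
      (∀ w ∈ Src, w.1 ∈ (chartAt H p).source ∧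
        (trivializationAt E (TangentSpace I : M → Type _) p).symmL ℝ w.1 w.2 ∈ expDomain cov w.1) ∧
      InjOn (fun w : M × E ↦ (w.1, expMap cov w.1
        ((trivializationAt E (TangentSpace I : M → Type _) p).symmL ℝ w.1 w.2))) Src ∧
      (∀ q ∈ W, ∀ z ∈ W, (q, Ξ q z) ∈ Src ∧
        expMap cov q ((trivializationAt E (TangentSpace I : M → Type _) p).symmL ℝ q (Ξ q z)) = z) ∧
      ContMDiffOn (I.prod I) 𝓘(ℝ, E) ∞ (uncurry Ξ) (W ×ˢ W) ∧
      ContMDiffOn (I.prod I) I.tangent ∞ (fun qz : M × M ↦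
        (TotalSpace.mk' E qz.1 ((trivializationAt E (TangentSpace I : M → Type _) p).symmL ℝ qz.1
          (Ξ qz.1 qz.2)) : TangentBundle I M)) (W ×ˢ W) := by
  set e := trivializationAt E (TangentSpace I : M → Type _) p with he
  have hbase : e.baseSet = (chartAt H p).source := TangentBundle.trivializationAt_baseSet p
  have hps : p ∈ e.baseSet := by rw [hbase]; exact mem_chart_source H p
  -- the inverse trivialisation as a smooth map `M × E → TM` over the base set
  set S : M × E → TangentBundle I M := fun w ↦ TotalSpace.mk' E w.1 (e.symmL ℝ w.1 w.2) with hS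
  have hSeq : ∀ w : M × E, w.1 ∈ e.baseSet → S w = e.toOpenPartialHomeomorph.symm w := by
    rintro ⟨b, ξ⟩ hb
    show TotalSpace.mk' E b (e.symmL ℝ b ξ) = e.toOpenPartialHomeomorph.symm (b, ξ)
    rw [e.symmL_apply hb]
    exact e.mk_symm hb ξ
  have hSs : ContMDiffOn (I.prod 𝓘(ℝ, E)) I.tangent ∞ S (e.baseSet ×ˢ univ) := by
    have h := e.contMDiffOn_symm (n := ∞) (IB := I)
    rw [e.target_eq] at h
    exact h.congr fun w hw ↦ hSeq w hw.1
  have hSproj : ∀ w : M × E, (S w).proj = w.1 := fun _ ↦ rfl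
  -- the open set where `exp ∘ S` is defined and smooth
  set 𝓔' : Set (TangentBundle I M) :=
    {v : TangentBundle I M | (1 : ℝ) ∈ maximalGeodesicDomain cov v.proj v.2} with h𝓔'
  have h𝓔'o : IsOpen 𝓔' := isOpen_setOf_one_mem_maximalGeodesicDomain (cov := cov) (k := 1) le_rfl
  set O : Set (M × E) := (e.baseSet ×ˢ univ) ∩ S ⁻¹' 𝓔' with hO
  have hOo : IsOpen O := hSs.continuousOn.isOpen_inter_preimage (e.open_baseSet.prod isOpen_univ) h𝓔'o
  -- the map `F (q, ξ) = (q, exp_q (e⁻¹ ξ))`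
  set F : M × E → M × M := fun w ↦ (w.1, expMap cov w.1 (e.symmL ℝ w.1 w.2)) with hF
  have hFS : ∀ w, F w = (w.1, expMap cov (S w).proj (S w).2) := fun _ ↦ rfl
  have hFs : ContMDiffOn (I.prod 𝓘(ℝ, E)) (I.prod I) ∞ F O := by
    have hexp := contMDiffOn_expMap_totalSpace (cov := cov) (k := (⊤ : ℕ∞)) le_top
    have h2 : ContMDiffOn (I.prod 𝓘(ℝ, E)) I ∞ (fun w : M × E ↦ expMap cov (S w).proj (S w).2) O :=
      hexp.comp (hSs.mono inter_subset_left) fun w hw ↦ hw.2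
    exact contMDiffOn_fst.prodMk h2
  -- `(q, 0) ∈ O` for `q` in the base set
  have hzero : ∀ q ∈ e.baseSet, e.symmL ℝ q (0 : E) = 0 := fun q _ ↦ map_zero _
  have hO0 : ∀ q ∈ e.baseSet, (q, (0 : E)) ∈ O := fun q hq ↦ by
    refine ⟨⟨hq, mem_univ _⟩, ?_⟩
    show (1 : ℝ) ∈ maximalGeodesicDomain cov q (e.symmL ℝ q (0 : E))
    rw [hzero q hq]
    exact (zero_mem_expDomain (cov := cov) q).2
  have hp0 : (p, (0 : E)) ∈ O := hO0 p hps
  -- the differential of `F` at `(p, 0)` is the shear `(a, b) ↦ (a, a + b)`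
  obtain ⟨L, hL⟩ := exists_shearEquiv (E := E)
  have hFdiff : MDifferentiableAt (I.prod 𝓘(ℝ, E)) (I.prod I) F (p, (0 : E)) :=
    (hFs.contMDiffAt (hOo.mem_nhds hp0)).mdifferentiableAt (by simp)
  have hmf : mfderiv (I.prod 𝓘(ℝ, E)) (I.prod I) F (p, (0 : E)) = (L : E × E →L[ℝ] E × E) := by
    -- the first partial map is (eventually) the diagonal
    have hev : (fun q : M ↦ F (q, (0 : E))) =ᶠ[𝓝 p] fun q : M ↦ (q, q) := by
      filter_upwards [e.open_baseSet.mem_nhds hps] with q hq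
      show (q, expMap cov q (e.symmL ℝ q (0 : E))) = (q, q)
      rw [hzero q hq, expMap_zero (cov := cov) q]
    have h1 : HasMFDerivAt I (I.prod I) (fun q : M ↦ F (q, (0 : E))) p
        ((ContinuousLinearMap.id ℝ E).prod (ContinuousLinearMap.id ℝ E)) :=
      ((hasMFDerivAt_id (I := I) p).prodMk (hasMFDerivAt_id (I := I) p)).congr_of_eventuallyEq hev
    -- the second partial map is `ξ ↦ (p, exp_p ξ)`
    have heq : (fun ξ : E ↦ F (p, ξ)) =
        fun ξ : E ↦ (p, expMap cov p (show TangentSpace I p from ξ)) := by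
      funext ξ
      show (p, expMap cov p (e.symmL ℝ p ξ)) = _
      rw [e.symmL_apply hps, he, trivializationAt_symm_self]
    have hexpd : HasMFDerivAt 𝓘(ℝ, E) I (fun ξ : E ↦ expMap cov p (show TangentSpace I p from ξ)) 0
        (ContinuousLinearMap.id ℝ E) := by
      have h := (mdifferentiableAt_expMap_zero (cov := cov) (k := 1) le_rfl p).hasMFDerivAt
      have hid : mfderiv 𝓘(ℝ, E) I (fun v : E ↦ expMap cov p (show TangentSpace I p from v)) 0 =
          ContinuousLinearMap.id ℝ E :=
        ContinuousLinearMap.ext fun w ↦ mfderiv_expMap_zero_apply (cov := cov) (k := 1) le_rfl p w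
      rwa [hid] at h
    have h2 : HasMFDerivAt 𝓘(ℝ, E) (I.prod I) (fun ξ : E ↦ F (p, ξ)) 0
        ((0 : E →L[ℝ] E).prod (ContinuousLinearMap.id ℝ E)) := by
      rw [heq]
      exact (hasMFDerivAt_const (I := 𝓘(ℝ, E)) (I' := I) p (0 : E)).prodMk hexpd
    apply ContinuousLinearMap.ext
    intro v
    rw [mfderiv_prod_eq_add_apply hFdiff]
    dsimp only
    rw [h1.mfderiv, h2.mfderiv]
    show ((v.1, v.1) : E × E) + ((0 : E →L[ℝ] E) v.2, v.2) = L (v.1, v.2)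
    rw [hL]
    simp
  -- the inverse function theorem
  obtain ⟨Φd, hpsrc, hFΦ⟩ := isLocalDiffeomorphAt_of_mfderiv (I := I.prod 𝓘(ℝ, E)) (J := I.prod I)
    (n := ∞) (by simp) hOo hp0 hFs L hmf
  -- the neighbourhood `W`
  have hF0 : F (p, (0 : E)) = (p, p) := by
    show (p, expMap cov p (e.symmL ℝ p (0 : E))) = (p, p)
    rw [hzero p hps, expMap_zero (cov := cov) p]
  have htgt : (p, p) ∈ Φd.target := by
    have h := Φd.map_source hpsrc
    rwa [← hFΦ hpsrc, hF0] at h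
  have hsymm0 : Φd.symm (p, p) = (p, (0 : E)) := by
    have h := Φd.left_inv hpsrc
    rwa [← hFΦ hpsrc, hF0] at h
  set Tg : Set (M × M) := Φd.target ∩ Φd.symm ⁻¹' (Φd.source ∩ O) with hTg
  have hTgo : IsOpen Tg :=
    Φd.symm.contMDiffOn.continuousOn.isOpen_inter_preimage Φd.open_target (Φd.open_source.inter hOo)
  have hpTg : (p, p) ∈ Tg := ⟨htgt, by rw [mem_preimage, hsymm0]; exact ⟨hpsrc, hp0⟩⟩
  obtain ⟨W, hWo, hpW, hWprod, hWsrc, hWbase⟩ : ∃ W : Set M, IsOpen W ∧ p ∈ W ∧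
      W ×ˢ W ⊆ Tg ∧ (∀ q ∈ W, (q, (0 : E)) ∈ Φd.source ∩ O) ∧ W ⊆ e.baseSet := by
    obtain ⟨U₁, hU₁, V₁, hV₁, hUV⟩ := mem_nhds_prod_iff.1 (hTgo.mem_nhds hpTg)
    have h0 : {q : M | (q, (0 : E)) ∈ Φd.source ∩ O} ∈ 𝓝 p := by
      have hc : Continuous fun q : M ↦ (q, (0 : E)) := continuous_id.prodMk continuous_const
      exact hc.continuousAt.preimage_mem_nhds ((Φd.open_source.inter hOo).mem_nhds ⟨hpsrc, hp0⟩)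
    obtain ⟨W, hWsub, hWo, hpW⟩ := mem_nhds_iff.1
      (inter_mem (inter_mem hU₁ hV₁) (inter_mem h0 (e.open_baseSet.mem_nhds hps)))
    refine ⟨W, hWo, hpW, ?_, fun q hq ↦ (hWsub hq).2.1, fun q hq ↦ (hWsub hq).2.2⟩
    rintro ⟨q, z⟩ ⟨hq, hz⟩
    exact hUV ⟨(hWsub hq).1.1, (hWsub hz).1.2⟩
  -- the source `Src` and the two-point inverse `Ξ`
  set Src : Set (M × E) := Φd.source ∩ O with hSrc
  set Ξ : M → M → E := fun q z ↦ (Φd.symm (q, z)).2 with hΞ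
  have hF1 : ∀ w : M × E, (F w).1 = w.1 := fun _ ↦ rfl
  have hsymm1 : ∀ q ∈ W, ∀ z ∈ W, (Φd.symm (q, z)).1 = q ∧ Φd.symm (q, z) ∈ Src ∧
      F (Φd.symm (q, z)) = (q, z) := by
    intro q hq z hz
    have hqz : (q, z) ∈ Tg := hWprod ⟨hq, hz⟩
    have hsrc : Φd.symm (q, z) ∈ Φd.source ∩ O := hqz.2
    have hFv : F (Φd.symm (q, z)) = (q, z) := by
      rw [hFΦ hsrc.1]
      exact Φd.right_inv hqz.1
    exact ⟨by rw [← hF1 (Φd.symm (q, z)), hFv], hsrc, hFv⟩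
  have hpair : ∀ q ∈ W, ∀ z ∈ W, Φd.symm (q, z) = (q, Ξ q z) := fun q hq z hz ↦
    Prod.ext (hsymm1 q hq z hz).1 rfl
  refine ⟨W, Src, Ξ, hWo, hpW, by rwa [← hbase], Φd.open_source.inter hOo,
    fun q hq ↦ hWsrc q hq, fun w hw ↦ ?_, ?_, fun q hq z hz ↦ ?_, ?_, ?_⟩
  · -- exp-domain membership on `Src`
    refine ⟨by rw [← hbase]; exact hw.2.1.1, ?_⟩
    exact ⟨hasMaximalGeodesic (cov := cov) _ _, hw.2.2⟩
  · -- injectivity: `F = Φd` on the source of the partial diffeomorphism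
    intro w₁ hw₁ w₂ hw₂ h12
    have h : Φd w₁ = Φd w₂ := by
      rw [← hFΦ hw₁.1, ← hFΦ hw₂.1]
      exact h12
    exact Φd.injOn hw₁.1 hw₂.1 h
  · -- the two-point inverse
    obtain ⟨h1, hsrc, hFv⟩ := hsymm1 q hq z hz
    refine ⟨by rw [← hpair q hq z hz]; exact hsrc, ?_⟩
    have h := congrArg Prod.snd hFv
    rw [hpair q hq z hz] at h
    exact h
  · -- smoothness of `Ξ`
    have h1 : ContMDiffOn (I.prod I) (I.prod 𝓘(ℝ, E)) ∞ Φd.symm (W ×ˢ W) :=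
      Φd.symm.contMDiffOn.mono fun w hw ↦ (hWprod hw).1
    exact (contMDiff_snd.comp_contMDiffOn h1).congr fun w _ ↦ rfl
  · -- smoothness of the `TM`-valued two-point inverse
    have h1 : ContMDiffOn (I.prod I) (I.prod 𝓘(ℝ, E)) ∞ Φd.symm (W ×ˢ W) :=
      Φd.symm.contMDiffOn.mono fun w hw ↦ (hWprod hw).1
    have h2 : ContMDiffOn (I.prod I) I.tangent ∞ (fun w : M × M ↦ S (Φd.symm w)) (W ×ˢ W) := by
      refine hSs.comp h1 fun w hw ↦ ⟨?_, mem_univ _⟩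
      rw [(hsymm1 w.1 hw.1 w.2 hw.2).1]
      exact hWbase hw.1
    refine h2.congr fun w hw ↦ ?_
    show TotalSpace.mk' E w.1 (e.symmL ℝ w.1 (Ξ w.1 w.2)) = S (Φd.symm w)
    obtain ⟨q, z⟩ := w
    show TotalSpace.mk' E q (e.symmL ℝ q (Ξ q z)) = S (Φd.symm (q, z))
    rw [hpair q hw.1 z hw.2]

end Literature.Geometry.Riemannian

end
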